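import Summits.QuantumFields.YangMills.Theorems.UnitScaleTiltMinimiserStabilityRegPrAvgActionDefect
import Literature.MathematicalPhysics.QuantumFieldTheory.Balaban1983to89.LatticeFieldCalculus
import HarnessLib

/-!
# Route `UnitScaleTilt`, crux K1 child «MinimiserStabilityRegPr» (stmt-QuantumFields-19200), registered stub `stub_prop7From14` (v4 828f5fb4a904d3be;
# leaf V3 «Prop 7 from a background (14)») — sub-lemma V3-B♭: [Balaban1985Variational] SECT. B (the expansion (22)–(26) of the action around a
# background) AT THE FLAT BACKGROUND `U₀ ≡ 1` IN THE EXP-FREE CHART `Y = U − 1`: the plaquette variable is the LINEAR curl of `Y` up to a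
# quadratic remainder, and the `SU(2)` Wilson action is the curl quadratic form `½Σ_p‖(∂Y)(p)‖²` up to a CUBIC remainder — explicit constants

Cell `ym3-torus` ∕ fleet seat `ym-ust-19200-p1` (HUMAN RULING D-0037, YM ladder rung R3).  Companion of the V3-D1 series (p451004, p452018, p454029:
the `k`-uniform coercivity `(8/17)L^{−2k}‖X‖² ≤ Σ_p(∂X)² ` on Landau-gauge bond fields with `Q_kX = 0`).  Print expands `A(e^{iηA}U₀)` to second
order ((22)–(26) p. 281–282, the Hessian `Δ(U₀)` of (31), the cubic-and-higher part `V` of (81)); at the flat background and in the chart `Y = U − 1`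
(no exponential map: `U(b) = 1 + Y(b)` with `1 + Y(b)` unitary) the same structure is elementary matrix algebra, which this file records with
constants, for the d = 3 route's group `SU(2)` read in `M₂(ℂ)` (operator norm, the tree's `dist1`).

WHAT IS PROVED (sorry-free, no definition; [folklore] matrix algebra, cited to the printed expansion it instantiates).
* §1 (any `n`, `M_n(ℂ)` with the `L²`-operator norm) `plaq_sub_one_sub_lin_eq` — the polynomial identity
  `U₁U₂U₃^*U₄^* − 1 − (Y₁+Y₂−Y₃−Y₄) = Y₁Y₂ + (Z₃+Y₃) + (Z₄+Y₄) + Z₃Z₄ + (Y₁+Y₂+Y₁Y₂)(Z₃+Z₄+Z₃Z₄)` (`Y_i = U_i − 1`, `Z_i = U_i^* − 1`);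
  `star_sub_one_add_sub_one` — `Z + Y = −ZY` for a unitary; **`norm_plaq_sub_one_sub_lin_le`** — for unitary `U₃, U₄` and `‖U₁ − 1‖, ‖U₃ − 1‖ ≤ 1`:
  `‖U₁U₂U₃^*U₄^* − 1 − (Y₁+Y₂−Y₃−Y₄)‖ ≤ 2(Σ_i‖Y_i‖)²` (polynomial form `…_le'` without smallness).
* §2 (any torus of `Setup`, `SU(N)`) `coe_plaqHol` — `U(∂p) = U(b₁)U(b₂)U(b₃)^*U(b₄)^*` in `M_N(ℂ)`; **`norm_plaqHol_sub_one_sub_curl_le`** —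
  `‖U(∂p) − 1 − (∂Y)(p)‖ ≤ 2·s_p²`, `∂ = LatticeFieldCalculus.curl 1` (the linear plaquette variable of [Balaban1984PropagatorsI] (1.2)) applied to the
  `M_N(ℂ)`-valued bond field `Y = U − 1`, `s_p = Σ_{b∈∂p}‖Y(b)‖`, whenever `‖Y‖ ≤ 1` on two bonds of `p`.
* §3 (`SU(2)`) `wilsonAction4_eq_half_sum_norm_sq` — `A(U) = ½Σ_p‖U(∂p) − 1‖²` ([Balaban1987RG1] (0.14) on `SU(2)`, tree
  `AvgActionDefect.one_sub_reTr_eq_half_dist1_sq_su2`); **`abs_wilsonAction4_sub_half_curl_sq_le`** — for `‖U(b) − 1‖ ≤ 1` at every bond,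
  `|A(U) − ½Σ_p‖(∂Y)(p)‖²| ≤ Σ_p (2s_p²‖(∂Y)(p)‖ + 6s_p⁴)`; `half_curl_sq_sub_le_wilsonAction4` — the lower bound alone.

HOW IT IS MEANT TO BE USED (next sub-lemma, not here).  With `‖(∂Y)(p)‖ ≤ ‖U(∂p) − 1‖ + 2s_p²`, the remainder is `≤ Σ_p (2‖U(∂p)−1‖ + 16 max_b‖Y(b)‖²)·s_p²
≤ 16(d−1)·(2a + 16δ²)·Σ_b‖Y(b)‖²` for plaquettes `< a` and bonds within `δ` of `1`: against the flat coercivity `(2/17)L^{−2k}Σ_b‖Y(b)‖²` of the V3-D1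
series (componentwise, Landau gauge, `Q_kY = 0`) this is the printed mechanism of (141)–(143) — `U ≡ 1` is a strict minimiser with quadratic growth
on the regular sup-ball of radii `a = O(L^{−2k})`, `δ = O(L^{−k})` of the gauge-fixed, average-zero slice — once the operator norm on `M₂(ℂ)` is
compared with the componentwise sums (V3-B♭′) and the slice with the family's fibre (V3-A/C/D1c).  Nothing of Bałaban's is asserted.

References: T. Bałaban, CMP 102 (1985) 277–309 [Balaban1985Variational] ((22)–(26) pp.281–282, (31) p.282, (141)–(143) p.299); CMP 95 (1984) 17–40
[Balaban1984PropagatorsI] ((1.2) p.18); CMP 98 (1985) 17–51 [Balaban1985Averaging] ((9) p.19); CMP 109 (1987) 249–301 [Balaban1987RG1] ((0.14) p.254).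
-/

noncomputable section

open scoped BigOperators Matrix.Norms.L2Operator

namespace Summit.QuantumFields.YangMills.Theorems.Prop7FlatExpansion

open Literature.MathematicalPhysics.QuantumFieldTheory.Balaban1983to89
open Finset LatticeFieldCalculus
open Summit.QuantumFields.YangMills.Theorems.AvgActionDefect (one_sub_reTr_eq_half_dist1_sq_su2)

/-! ## §1 Four unitaries: the plaquette product minus one is the signed sum of the deviations up to second order -/

section Algebra

variable {n : Type*} [Fintype n] [DecidableEq n]

/-- The polynomial identity behind (22)–(24) of [Balaban1985Variational] at `U₀ = 1`, in the deviations `Y_i = U_i − 1`, `Z_i = U_i^* − 1`: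
`U₁U₂U₃^*U₄^* − 1 − (Y₁ + Y₂ − Y₃ − Y₄) = Y₁Y₂ + (Z₃ + Y₃) + (Z₄ + Y₄) + Z₃Z₄ + (Y₁ + Y₂ + Y₁Y₂)(Z₃ + Z₄ + Z₃Z₄)`. [folklore] -/
theorem plaq_sub_one_sub_lin_eq (U₁ U₂ U₃ U₄ : Matrix n n ℂ) :
    U₁ * U₂ * star U₃ * star U₄ - 1 - ((U₁ - 1) + (U₂ - 1) - (U₃ - 1) - (U₄ - 1))
      = (U₁ - 1) * (U₂ - 1) + ((star U₃ - 1) + (U₃ - 1)) + ((star U₄ - 1) + (U₄ - 1)) + (star U₃ - 1) * (star U₄ - 1)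
        + ((U₁ - 1) + (U₂ - 1) + (U₁ - 1) * (U₂ - 1)) * ((star U₃ - 1) + (star U₄ - 1) + (star U₃ - 1) * (star U₄ - 1)) := by
  noncomm_ring

/-- For a unitary `U`: `(U^* − 1) + (U − 1) = −(U^* − 1)(U − 1)` (from `U^*U = 1`). [folklore] -/
theorem star_sub_one_add_sub_one {U : Matrix n n ℂ} (hU : U ∈ Matrix.unitaryGroup n ℂ) :
    (star U - 1) + (U - 1) = -((star U - 1) * (U - 1)) := by
  have h : star U * U = 1 := Matrix.mem_unitaryGroup_iff'.mp hU
  rw [show (star U - 1) * (U - 1) = star U * U - star U - U + 1 by noncomm_ring, h]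
  abel

/-- The remainder as a polynomial in the four deviation norms (no smallness needed): with `a_i = ‖U_i − 1‖` (operator norms),
`‖U₁U₂U₃^*U₄^* − 1 − (Y₁ + Y₂ − Y₃ − Y₄)‖ ≤ a₁a₂ + a₃² + a₄² + a₃a₄ + (a₁ + a₂ + a₁a₂)(a₃ + a₄ + a₃a₄)` for unitary `U₃, U₄`.
[cite: Balaban1985Variational, (22)-(26) pp.281-282] -/
theorem norm_plaq_sub_one_sub_lin_le' {U₁ U₂ U₃ U₄ : Matrix n n ℂ} (h₃ : U₃ ∈ Matrix.unitaryGroup n ℂ) (h₄ : U₄ ∈ Matrix.unitaryGroup n ℂ) :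
    ‖U₁ * U₂ * star U₃ * star U₄ - 1 - ((U₁ - 1) + (U₂ - 1) - (U₃ - 1) - (U₄ - 1))‖
      ≤ ‖U₁ - 1‖ * ‖U₂ - 1‖ + ‖U₃ - 1‖ * ‖U₃ - 1‖ + ‖U₄ - 1‖ * ‖U₄ - 1‖ + ‖U₃ - 1‖ * ‖U₄ - 1‖
        + (‖U₁ - 1‖ + ‖U₂ - 1‖ + ‖U₁ - 1‖ * ‖U₂ - 1‖) * (‖U₃ - 1‖ + ‖U₄ - 1‖ + ‖U₃ - 1‖ * ‖U₄ - 1‖) := by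
  rw [plaq_sub_one_sub_lin_eq, star_sub_one_add_sub_one h₃, star_sub_one_add_sub_one h₄]
  have hz₃ : ‖star U₃ - 1‖ = ‖U₃ - 1‖ := by rw [← norm_star (U₃ - 1), star_sub, star_one]
  have hz₄ : ‖star U₄ - 1‖ = ‖U₄ - 1‖ := by rw [← norm_star (U₄ - 1), star_sub, star_one]
  have t1 : ‖(U₁ - 1) * (U₂ - 1)‖ ≤ ‖U₁ - 1‖ * ‖U₂ - 1‖ := norm_mul_le _ _
  have t2 : ‖-((star U₃ - 1) * (U₃ - 1))‖ ≤ ‖U₃ - 1‖ * ‖U₃ - 1‖ := by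
    rw [norm_neg, ← hz₃]; exact (norm_mul_le _ _).trans (by rw [hz₃])
  have t3 : ‖-((star U₄ - 1) * (U₄ - 1))‖ ≤ ‖U₄ - 1‖ * ‖U₄ - 1‖ := by
    rw [norm_neg, ← hz₄]; exact (norm_mul_le _ _).trans (by rw [hz₄])
  have t4 : ‖(star U₃ - 1) * (star U₄ - 1)‖ ≤ ‖U₃ - 1‖ * ‖U₄ - 1‖ := by
    rw [← hz₃, ← hz₄]; exact norm_mul_le _ _
  have hα : ‖(U₁ - 1) + (U₂ - 1) + (U₁ - 1) * (U₂ - 1)‖ ≤ ‖U₁ - 1‖ + ‖U₂ - 1‖ + ‖U₁ - 1‖ * ‖U₂ - 1‖ :=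
    (norm_add_le _ _).trans (add_le_add (norm_add_le _ _) t1)
  have hβ : ‖(star U₃ - 1) + (star U₄ - 1) + (star U₃ - 1) * (star U₄ - 1)‖ ≤ ‖U₃ - 1‖ + ‖U₄ - 1‖ + ‖U₃ - 1‖ * ‖U₄ - 1‖ := by
    refine (norm_add_le _ _).trans (add_le_add ((norm_add_le _ _).trans ?_) t4)
    rw [hz₃, hz₄]
  have hβ0 : 0 ≤ ‖U₁ - 1‖ + ‖U₂ - 1‖ + ‖U₁ - 1‖ * ‖U₂ - 1‖ :=
    add_nonneg (add_nonneg (norm_nonneg _) (norm_nonneg _)) (mul_nonneg (norm_nonneg _) (norm_nonneg _))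
  have t5 : ‖((U₁ - 1) + (U₂ - 1) + (U₁ - 1) * (U₂ - 1)) * ((star U₃ - 1) + (star U₄ - 1) + (star U₃ - 1) * (star U₄ - 1))‖
      ≤ (‖U₁ - 1‖ + ‖U₂ - 1‖ + ‖U₁ - 1‖ * ‖U₂ - 1‖) * (‖U₃ - 1‖ + ‖U₄ - 1‖ + ‖U₃ - 1‖ * ‖U₄ - 1‖) :=
    (norm_mul_le ((U₁ - 1) + (U₂ - 1) + (U₁ - 1) * (U₂ - 1)) ((star U₃ - 1) + (star U₄ - 1) + (star U₃ - 1) * (star U₄ - 1))).trans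
      (mul_le_mul hα hβ (norm_nonneg ((star U₃ - 1) + (star U₄ - 1) + (star U₃ - 1) * (star U₄ - 1))) hβ0)
  exact norm_add_le_of_le (norm_add_le_of_le (norm_add_le_of_le (norm_add_le_of_le t1 t2) t3) t4) t5

/-- The scalar bookkeeping: for `0 ≤ a_i ≤ 1`, `a₁a₂ + a₃² + a₄² + a₃a₄ + (a₁ + a₂ + a₁a₂)(a₃ + a₄ + a₃a₄) ≤ 2(a₁ + a₂ + a₃ + a₄)²`. [folklore] -/
theorem poly_le_two_mul_sq {a₁ a₂ a₃ a₄ : ℝ} (h₁ : 0 ≤ a₁) (h₂ : 0 ≤ a₂) (h₃ : 0 ≤ a₃) (h₄ : 0 ≤ a₄)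
    (g₁ : a₁ ≤ 1) (g₃ : a₃ ≤ 1) :
    a₁ * a₂ + a₃ * a₃ + a₄ * a₄ + a₃ * a₄ + (a₁ + a₂ + a₁ * a₂) * (a₃ + a₄ + a₃ * a₄) ≤ 2 * (a₁ + a₂ + a₃ + a₄) ^ 2 := by
  have e1 : a₁ * a₂ ≤ a₂ := by nlinarith
  have e2 : a₃ * a₄ ≤ a₄ := by nlinarith
  have e3 : (a₁ + a₂ + a₁ * a₂) * (a₃ + a₄ + a₃ * a₄) ≤ (2 * (a₁ + a₂)) * (2 * (a₃ + a₄)) :=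
    mul_le_mul (by linarith) (by linarith) (by positivity) (by positivity)
  nlinarith [mul_nonneg h₁ h₂, mul_nonneg h₃ h₄, mul_nonneg h₁ h₃, mul_nonneg h₁ h₄, mul_nonneg h₂ h₃, mul_nonneg h₂ h₄,
    sq_nonneg (a₁ - a₂), sq_nonneg (a₃ - a₄)]

/-- **THE PLAQUETTE VARIABLE IS THE LINEAR CURL OF THE DEVIATIONS UP TO SECOND ORDER**: for unitaries `U₃, U₄` and `‖U₁ − 1‖, ‖U₃ − 1‖ ≤ 1`,
`‖U₁U₂U₃^*U₄^* − 1 − ((U₁−1) + (U₂−1) − (U₃−1) − (U₄−1))‖ ≤ 2·(Σ_i ‖U_i − 1‖)²` (operator norm). [cite: Balaban1985Variational, (22)-(26) pp.281-282] -/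
theorem norm_plaq_sub_one_sub_lin_le {U₁ U₂ U₃ U₄ : Matrix n n ℂ} (h₃ : U₃ ∈ Matrix.unitaryGroup n ℂ) (h₄ : U₄ ∈ Matrix.unitaryGroup n ℂ)
    (ha₁ : ‖U₁ - 1‖ ≤ 1) (ha₃ : ‖U₃ - 1‖ ≤ 1) :
    ‖U₁ * U₂ * star U₃ * star U₄ - 1 - ((U₁ - 1) + (U₂ - 1) - (U₃ - 1) - (U₄ - 1))‖
      ≤ 2 * (‖U₁ - 1‖ + ‖U₂ - 1‖ + ‖U₃ - 1‖ + ‖U₄ - 1‖) ^ 2 :=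
  (norm_plaq_sub_one_sub_lin_le' h₃ h₄).trans
    (poly_le_two_mul_sq (norm_nonneg _) (norm_nonneg _) (norm_nonneg _) (norm_nonneg _) ha₁ ha₃)

end Algebra

/-! ## §2 On the lattice: the plaquette variable of an `SU(N)` field versus the linear curl of `Y = U − 1` -/

section Lattice

variable {P : Params} {j : ℕ} {N : ℕ} [NeZero N]

omit [NeZero N] in
/-- In `M_N(ℂ)` the inverse of a special unitary is its adjoint. [folklore] -/
private theorem coe_inv_su (g : Matrix.specialUnitaryGroup (Fin N) ℂ) :
    ((g⁻¹ : Matrix.specialUnitaryGroup (Fin N) ℂ) : Matrix (Fin N) (Fin N) ℂ) = star (g : Matrix (Fin N) (Fin N) ℂ) := rfl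

/-- The plaquette variable read in `M_N(ℂ)`: `U(∂p) = U(b₁)U(b₂)U(b₃)^*U(b₄)^*` ([Balaban1985Averaging] (9)). [cite: Balaban1985Averaging, (9) p.19] -/
theorem coe_plaqHol (U : GaugeField P j (Matrix.specialUnitaryGroup (Fin N) ℂ)) (p : Plaq P j) :
    ((GaugeField.plaqHol U p : Matrix.specialUnitaryGroup (Fin N) ℂ) : Matrix (Fin N) (Fin N) ℂ)
      = (U ⟨p.src, p.μ⟩ : Matrix (Fin N) (Fin N) ℂ) * (U ⟨p.src.shift p.μ, p.ν⟩ : Matrix (Fin N) (Fin N) ℂ)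
        * star (U ⟨p.src.shift p.ν, p.μ⟩ : Matrix (Fin N) (Fin N) ℂ) * star (U ⟨p.src, p.ν⟩ : Matrix (Fin N) (Fin N) ℂ) := by
  simp only [GaugeField.plaqHol, Submonoid.coe_mul, coe_inv_su]

/-- **[Balaban1985Variational] SECT. B AT THE FLAT BACKGROUND, EXP-FREE CHART `Y = U − 1`, PER PLAQUETTE**: for an `SU(N)` configuration with
`‖U(b) − 1‖ ≤ 1` on the bonds of `p`, the plaquette variable minus one is the LINEAR lattice curl ([Balaban1984PropagatorsI] (1.2),
`LatticeFieldCalculus.curl 1`) of the `M_N(ℂ)`-valued bond field `Y = U − 1` up to `2·(Σ_{b∈∂p}‖Y(b)‖)²`.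
[cite: Balaban1985Variational, (22)-(26) pp.281-282] -/
theorem norm_plaqHol_sub_one_sub_curl_le (U : GaugeField P j (Matrix.specialUnitaryGroup (Fin N) ℂ)) (p : Plaq P j)
    (h₁ : ‖(U ⟨p.src, p.μ⟩ : Matrix (Fin N) (Fin N) ℂ) - 1‖ ≤ 1) (h₃ : ‖(U ⟨p.src.shift p.ν, p.μ⟩ : Matrix (Fin N) (Fin N) ℂ) - 1‖ ≤ 1) :
    ‖((GaugeField.plaqHol U p : Matrix.specialUnitaryGroup (Fin N) ℂ) : Matrix (Fin N) (Fin N) ℂ) - 1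
        - curl 1 (fun b : PBond P j => (U b : Matrix (Fin N) (Fin N) ℂ) - 1) p‖
      ≤ 2 * (‖(U ⟨p.src, p.μ⟩ : Matrix (Fin N) (Fin N) ℂ) - 1‖ + ‖(U ⟨p.src.shift p.μ, p.ν⟩ : Matrix (Fin N) (Fin N) ℂ) - 1‖
          + ‖(U ⟨p.src.shift p.ν, p.μ⟩ : Matrix (Fin N) (Fin N) ℂ) - 1‖ + ‖(U ⟨p.src, p.ν⟩ : Matrix (Fin N) (Fin N) ℂ) - 1‖) ^ 2 := by
  rw [coe_plaqHol, curl, one_smul]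
  exact norm_plaq_sub_one_sub_lin_le (U ⟨p.src.shift p.ν, p.μ⟩).2.1 (U ⟨p.src, p.ν⟩).2.1 h₁ h₃

end Lattice

/-! ## §3 The `SU(2)` Wilson action is the curl quadratic form of `Y = U − 1` up to a cubic remainder -/

section Action

variable {P : Params} {j : ℕ}

/-- **THE `SU(2)` WILSON ACTION IN THE CHART `Y = U − 1`**: `A(U) = ½·Σ_p ‖U(∂p) − 1‖²` (tree: `one_sub_reTr_eq_half_dist1_sq_su2`, [Balaban1987RG1]
(0.14) as an operator-norm identity on `SU(2)`). [cite: Balaban1987RG1, (0.14) p.254] -/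
theorem wilsonAction4_eq_half_sum_norm_sq (U : GaugeField P j (Matrix.specialUnitaryGroup (Fin 2) ℂ)) :
    wilsonAction4 U = ∑ p : Plaq P j,
      1 / 2 * ‖((GaugeField.plaqHol U p : Matrix.specialUnitaryGroup (Fin 2) ℂ) : Matrix (Fin 2) (Fin 2) ℂ) - 1‖ ^ 2 := by
  unfold wilsonAction4 wilsonAction
  refine Finset.sum_congr rfl fun p _ => ?_
  rw [one_mul, one_sub_reTr_eq_half_dist1_sq_su2]
  rfl

/-- Elementary: if `|m − t| ≤ e` with `m, t, e ≥ 0` then `½t² − te − (3/2)e² ≤ ½m² ≤ ½t² + te + ½e²`. [folklore] -/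
theorem half_sq_sandwich {m t e : ℝ} (hm : 0 ≤ m) (ht : 0 ≤ t) (he : 0 ≤ e) (h : |m - t| ≤ e) :
    1 / 2 * t ^ 2 - t * e - 3 / 2 * e ^ 2 ≤ 1 / 2 * m ^ 2 ∧ 1 / 2 * m ^ 2 ≤ 1 / 2 * t ^ 2 + t * e + 1 / 2 * e ^ 2 := by
  obtain ⟨h1, h2⟩ := abs_le.mp h
  constructor <;> nlinarith

/-- **SECT. B AT THE FLAT BACKGROUND FOR THE `SU(2)` WILSON ACTION** ([Balaban1985Variational] (22)–(26) with `U₀ = 1`, in the exp-free chart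
`Y = U − 1`): if `‖U(b) − 1‖ ≤ 1` at every bond, then with `s_p = Σ_{b∈∂p} ‖U(b) − 1‖`,
`|A(U) − ½·Σ_p ‖(∂Y)(p)‖²| ≤ Σ_p (2 s_p²·‖(∂Y)(p)‖ + 6 s_p⁴)` — the Wilson action is the curl quadratic form of the deviation field
(`LatticeFieldCalculus.curl 1`, operator norm on `M₂(ℂ)`) up to a CUBIC remainder. [cite: Balaban1985Variational, (22)-(26) pp.281-282] -/
theorem abs_wilsonAction4_sub_half_curl_sq_le (U : GaugeField P j (Matrix.specialUnitaryGroup (Fin 2) ℂ))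
    (hU : ∀ b : PBond P j, ‖(U b : Matrix (Fin 2) (Fin 2) ℂ) - 1‖ ≤ 1) :
    |wilsonAction4 U - ∑ p : Plaq P j, 1 / 2 * ‖curl 1 (fun b : PBond P j => (U b : Matrix (Fin 2) (Fin 2) ℂ) - 1) p‖ ^ 2|
      ≤ ∑ p : Plaq P j,
        (2 * (‖(U ⟨p.src, p.μ⟩ : Matrix (Fin 2) (Fin 2) ℂ) - 1‖ + ‖(U ⟨p.src.shift p.μ, p.ν⟩ : Matrix (Fin 2) (Fin 2) ℂ) - 1‖
              + ‖(U ⟨p.src.shift p.ν, p.μ⟩ : Matrix (Fin 2) (Fin 2) ℂ) - 1‖ + ‖(U ⟨p.src, p.ν⟩ : Matrix (Fin 2) (Fin 2) ℂ) - 1‖) ^ 2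
            * ‖curl 1 (fun b : PBond P j => (U b : Matrix (Fin 2) (Fin 2) ℂ) - 1) p‖
          + 6 * (‖(U ⟨p.src, p.μ⟩ : Matrix (Fin 2) (Fin 2) ℂ) - 1‖ + ‖(U ⟨p.src.shift p.μ, p.ν⟩ : Matrix (Fin 2) (Fin 2) ℂ) - 1‖
              + ‖(U ⟨p.src.shift p.ν, p.μ⟩ : Matrix (Fin 2) (Fin 2) ℂ) - 1‖ + ‖(U ⟨p.src, p.ν⟩ : Matrix (Fin 2) (Fin 2) ℂ) - 1‖) ^ 4) := by
  rw [wilsonAction4_eq_half_sum_norm_sq, ← Finset.sum_sub_distrib]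
  refine (Finset.abs_sum_le_sum_abs _ _).trans (Finset.sum_le_sum fun p _ => ?_)
  set m := ‖((GaugeField.plaqHol U p : Matrix.specialUnitaryGroup (Fin 2) ℂ) : Matrix (Fin 2) (Fin 2) ℂ) - 1‖ with hm
  set t := ‖curl 1 (fun b : PBond P j => (U b : Matrix (Fin 2) (Fin 2) ℂ) - 1) p‖ with ht
  set s := ‖(U ⟨p.src, p.μ⟩ : Matrix (Fin 2) (Fin 2) ℂ) - 1‖ + ‖(U ⟨p.src.shift p.μ, p.ν⟩ : Matrix (Fin 2) (Fin 2) ℂ) - 1‖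
      + ‖(U ⟨p.src.shift p.ν, p.μ⟩ : Matrix (Fin 2) (Fin 2) ℂ) - 1‖ + ‖(U ⟨p.src, p.ν⟩ : Matrix (Fin 2) (Fin 2) ℂ) - 1‖ with hs
  have he : |m - t| ≤ 2 * s ^ 2 := by
    rw [hm, ht]
    refine (abs_norm_sub_norm_le _ _).trans ?_
    exact norm_plaqHol_sub_one_sub_curl_le U p (hU _) (hU _)
  have hm0 : 0 ≤ m := norm_nonneg _
  have ht0 : 0 ≤ t := norm_nonneg _
  have hs0 : 0 ≤ s := by
    rw [hs]
    exact add_nonneg (add_nonneg (add_nonneg (norm_nonneg _) (norm_nonneg _)) (norm_nonneg _)) (norm_nonneg _)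
  have he0 : 0 ≤ 2 * s ^ 2 := by nlinarith [sq_nonneg s]
  obtain ⟨lo, hi⟩ := half_sq_sandwich hm0 ht0 he0 he
  rw [abs_le]
  constructor <;> nlinarith

/-- **ONE-SIDED FORM** (the direction used for minimality): `A(U) ≥ ½·Σ_p‖(∂Y)(p)‖² − Σ_p (2s_p²‖(∂Y)(p)‖ + 6s_p⁴)`.
[cite: Balaban1985Variational, (141)-(143) p.299] -/
theorem half_curl_sq_sub_le_wilsonAction4 (U : GaugeField P j (Matrix.specialUnitaryGroup (Fin 2) ℂ))
    (hU : ∀ b : PBond P j, ‖(U b : Matrix (Fin 2) (Fin 2) ℂ) - 1‖ ≤ 1) :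
    ∑ p : Plaq P j, 1 / 2 * ‖curl 1 (fun b : PBond P j => (U b : Matrix (Fin 2) (Fin 2) ℂ) - 1) p‖ ^ 2
      - ∑ p : Plaq P j,
        (2 * (‖(U ⟨p.src, p.μ⟩ : Matrix (Fin 2) (Fin 2) ℂ) - 1‖ + ‖(U ⟨p.src.shift p.μ, p.ν⟩ : Matrix (Fin 2) (Fin 2) ℂ) - 1‖
              + ‖(U ⟨p.src.shift p.ν, p.μ⟩ : Matrix (Fin 2) (Fin 2) ℂ) - 1‖ + ‖(U ⟨p.src, p.ν⟩ : Matrix (Fin 2) (Fin 2) ℂ) - 1‖) ^ 2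
            * ‖curl 1 (fun b : PBond P j => (U b : Matrix (Fin 2) (Fin 2) ℂ) - 1) p‖
          + 6 * (‖(U ⟨p.src, p.μ⟩ : Matrix (Fin 2) (Fin 2) ℂ) - 1‖ + ‖(U ⟨p.src.shift p.μ, p.ν⟩ : Matrix (Fin 2) (Fin 2) ℂ) - 1‖
              + ‖(U ⟨p.src.shift p.ν, p.μ⟩ : Matrix (Fin 2) (Fin 2) ℂ) - 1‖ + ‖(U ⟨p.src, p.ν⟩ : Matrix (Fin 2) (Fin 2) ℂ) - 1‖) ^ 4)
      ≤ wilsonAction4 U := by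
  have h := abs_wilsonAction4_sub_half_curl_sq_le U hU
  rw [abs_le] at h
  linarith [h.1]

end Action

end Summit.QuantumFields.YangMills.Theorems.Prop7FlatExpansion

end
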